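import Summits.BirchSwinnertonDyer.Rank1Residual.GaloisImage.KolyvaginComparisonOperatorTorsion
import Summits.BirchSwinnertonDyer.Rank1Residual.GaloisImage.SakamotoN11Instance
import Summits.BirchSwinnertonDyer.Rank1Residual.GaloisImage.TorsionPadicIntCoefficientsLocal
import Literature.NumberTheory.EllipticCurves.Kato2004.EulerSystemValues
import HarnessLib

set_option autoImplicit false

-- the summit and its single problem are both named `BirchSwinnertonDyer` (registry layout D-0017)
set_option linter.dupNamespace false

/-!
# Crux `KatoDivisibilityX9` (stmt-BirchSwinnertonDyer-20547), line `graded_euler_loss`, stub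
# `stub_reciprocityPkAX9` (hG34ᵍ), item (M1) of `hKolyRecPk`, file 4: the Euler factor of an
# `E[p^{k+1}]`-SPLIT Frobenius MODULO `p^{k+1}` — `q ≡ 1`, `a_q ≡ 2`, `P(Fr_q⁻¹ | T_pE*; X) ≡ (1 − X)² (mod p^{k+1})`

Seat `bsd-line-k6-p4` (prover-bsd-line-k6-p4-g5-0, wave-2 stub worker B).  THEOREMS ONLY (no definition, no named
fact, no `sorry`); `--supports stmt-BirchSwinnertonDyer-20547 --as helper`.  Level-`p^{k+1}` twin of lur-a's
`EulerFactorModP.map_toZMod_rubinEulerFactor_eq_of_galoisRepTorsion_eq_one` (`…X9EulerFactorModP` §4, modulo `p`,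
via Serre's trace congruence).  Here, at a good place `v ∤ p` with an arithmetic Frobenius `Fr` acting TRIVIALLY on
`E[p^{k+1}]` (`galoisRepTorsion W ((p:ℤ)^(k+1)) Fr = 1`, the hypothesis of `hKolyRecPk`), the characteristic
polynomial of `Fr` on the free rank-two `ℤ/p^{k+1}`-module `E[p^{k+1}]` is both `(X − 1)²` (`LinearMap.charpoly_one`)
and `X² − a_vX + N(v)` (n1011-p13 `TorsionComparison.charpoly_zmodEnd_torsion_frobenius`, Silverman C.21.3 reduced
mod `p^{k+1}`); comparing coefficients gives `N(v) ≡ 1` and `a_v ≡ 2 (mod p^{k+1})`, whence Rubin's factor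
`1 − (a_v/N(v))X + (1/N(v))X²` (`Rat.rubinEulerFactor_galoisRepTate`) reduces to `(1 − X)²`.  The
`ℤ/p^{k+1}`-structure facts on `E[p^{k+1}]` (free of rank two) are transported from n1011's instances on the
spelling `E[p^k·p]` (`SakamotoN11Instance`, `TorsionCoeff.geomTorsion_pow_succ_eq`), exactly as in
`KolyvaginPrime.isKolyvaginPrime_succ_of_mem_frobeniusClassPrimes`.

* `natCast_eq_one_and_frobeniusTrace_eq_two_of_galoisRepTorsion_pow_eq_one` — the two congruences;
* **`map_toZModPow_rubinEulerFactor_eq_of_galoisRepTorsion_pow_eq_one`** — `P ≡ (1 − X)² (mod p^{k+1})`;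
* `pow_dvd_primesEquiv_sub_one_of_galoisRepTorsion_pow_eq_one` — `p^{k+1} ∣ ℓ − 1`.

References: K. Rubin, *Euler Systems* (2000) Def. 2.1.1 [Rubin2000]; J. H. Silverman, *AEC* V.2.3, C.21.3
[SilvermanAEC2009]; C.-H. Kim, AJM 148 (2026) §2.3.2 ("`P_ℓ(x) ≡ (x − 1)² mod I_ℓ`"); J.-P. Serre, Invent. Math. 15
(1972) §1.11 [Serre1972].
-/

noncomputable section

open scoped NumberField
open Polynomial Field IsDedekindDomain
open Literature.NumberTheory.GaloisRepresentations
open Literature.NumberTheory.GaloisRepresentations.DiscreteGaloisModule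
open Literature.NumberTheory.EllipticCurves
open Literature.NumberTheory.EllipticCurves.Kato2004.EulerSystemValues
open WeierstrassCurve (geomPoints geomTorsion galoisRepTorsion)
open Rat.HeightOneSpectrum
open Summit.BirchSwinnertonDyer.Rank1Residual.GaloisImage

namespace Summit.BirchSwinnertonDyer.BirchSwinnertonDyer.Theorems.OneSidedTwistSqueezeX9KatoDivisibilityX9KolyvaginReciprocityPkEulerFactor

variable (W : WeierstrassCurve ℚ) [W.IsElliptic] [W.IsGloballyMinimal] (p : ℕ) [Fact p.Prime] (k : ℕ)

set_option backward.isDefEq.respectTransparency false in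
/-- **`N(v) ≡ 1` and `a_v ≡ 2 (mod p^{k+1})` at an `E[p^{k+1}]`-split Frobenius**: at a good place `v ∤ p` with an
arithmetic Frobenius `Fr` acting trivially on `E[p^{k+1}]`, `charpoly(Fr | E[p^{k+1}]) = (X − 1)² = X² − a_vX + N(v)`
in `(ℤ/p^{k+1})[X]`. [cite: SilvermanAEC2009, Prop. V.2.3 and Thm. C.21.3] [cite: Serre1972, §1.11] -/
theorem natCast_eq_one_and_frobeniusTrace_eq_two_of_galoisRepTorsion_pow_eq_one
    {v : HeightOneSpectrum (𝓞 ℚ)} (hne : ((primesEquiv v : Nat.Primes) : ℕ) ≠ p)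
    (hgood : W.HasGoodReductionAt v) {Fr : absoluteGaloisGroup ℚ} (hFr : IsArithFrobAtPlace ℚ v Fr)
    (h1 : galoisRepTorsion W ((p : ℤ) ^ (k + 1)) Fr = 1) :
    ((((primesEquiv v : Nat.Primes) : ℕ) : ℕ) : ZMod (p ^ (k + 1))) = 1 ∧
      ((W.frobeniusTrace (primesEquiv v) : ℤ) : ZMod (p ^ (k + 1))) = 2 := by
  have hp : p.Prime := Fact.out
  haveI : Fact (1 < p ^ (k + 1)) := ⟨Nat.one_lt_pow (Nat.succ_ne_zero k) hp.one_lt⟩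
  -- the `ℤ/p^{k+1}`-module `E[p^{k+1}]`, free of rank two (transport from the `E[p^k·p]` spelling)
  letI instM : Module (ZMod (p ^ (k + 1))) (geomTorsion W ((p ^ (k + 1) : ℕ) : ℤ)) :=
    AddSubgroup.torsionBy.zmodModule
  let eA : geomTorsion W ((p ^ (k + 1) : ℕ) : ℤ) ≃+ geomTorsion W ((p : ℤ) ^ k * (p : ℤ)) :=
    AddEquiv.addSubgroupCongr (TorsionCoeff.geomTorsion_pow_succ_eq W p k)
  let eL : geomTorsion W ((p ^ (k + 1) : ℕ) : ℤ) ≃ₗ[ZMod (p ^ (k + 1))]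
      geomTorsion W ((p : ℤ) ^ k * (p : ℤ)) :=
    LinearEquiv.ofBijective (eA.toAddMonoidHom.toZModLinearMap (p ^ (k + 1)))
      (by rw [AddMonoidHom.coe_toZModLinearMap]; exact eA.bijective)
  letI instFree : Module.Free (ZMod (p ^ (k + 1))) (geomTorsion W ((p ^ (k + 1) : ℕ) : ℤ)) :=
    Module.Free.of_equiv eL.symm
  letI instFin : Module.Finite (ZMod (p ^ (k + 1))) (geomTorsion W ((p ^ (k + 1) : ℕ) : ℤ)) :=
    Module.Finite.equiv eL.symm
  have hrank : Module.finrank (ZMod (p ^ (k + 1))) (geomTorsion W ((p ^ (k + 1) : ℕ) : ℤ)) = 2 := by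
    obtain ⟨e⟩ := nonempty_linearEquiv_prod_geomTorsion W p k
    rw [← (e.trans eL.symm).finrank_eq, Module.finrank_prod, Module.finrank_self]
  -- `charpoly(Fr) = X² − a_v X + N(v)` and `Fr = 1` on `E[p^{k+1}]`
  have hchar := TorsionComparison.charpoly_zmodEnd_torsion_frobenius W p (k + 1) hne hgood hFr
  have h1' : galoisRepTorsion W ((p ^ (k + 1) : ℕ) : ℤ) Fr = 1 := by rw [Nat.cast_pow]; exact h1
  have hone : (W.torsionGaloisModule ((p ^ (k + 1) : ℕ) : ℤ)).zmodEnd (p ^ (k + 1)) Fr = 1 := by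
    apply LinearMap.ext
    intro x
    rw [zmodEnd_apply, WeierstrassCurve.torsionGaloisModule_apply_apply, Module.End.one_apply,
      ← WeierstrassCurve.galoisRepTorsion_apply, h1']
    rfl
  rw [hone, LinearMap.charpoly_one, hrank] at hchar
  -- compare coefficients of `(X − 1)² = X² − a X + ℓ`
  have key : (X ^ 2 - C (2 : ZMod (p ^ (k + 1))) * X + C 1 : (ZMod (p ^ (k + 1)))[X]) =
      X ^ 2 - C ((W.frobeniusTrace (primesEquiv v) : ℤ) : ZMod (p ^ (k + 1))) * X +
        C ((((primesEquiv v : Nat.Primes) : ℕ) : ℕ) : ZMod (p ^ (k + 1))) := by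
    rw [← hchar, map_ofNat, C_1]
    ring
  have h0 := congrArg (fun P : (ZMod (p ^ (k + 1)))[X] => P.coeff 0) key
  have h1c := congrArg (fun P : (ZMod (p ^ (k + 1)))[X] => P.coeff 1) key
  simp only [coeff_add, coeff_sub, coeff_X_pow, coeff_C_mul, coeff_X, coeff_C] at h0 h1c
  norm_num at h0 h1c
  exact ⟨h0.symm, by rw [← neg_inj, ← h1c]⟩

/-- **The Euler factor of an `E[p^{k+1}]`-split Frobenius is `(1 − X)²` modulo `p^{k+1}`.**  At a good place
`v ∤ p` with an arithmetic Frobenius `Fr` acting trivially on `E[p^{k+1}]`, Rubin's Euler factor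
`P(Fr⁻¹ | T_pE*; X) = 1 − (a_v/N(v))X + (1/N(v))X²` (`Rat.rubinEulerFactor_galoisRepTate`) reduces to
`1 − 2X + X² = (1 − X)²` over `ℤ/p^{k+1}` (`a_v ≡ 2`, `N(v) ≡ 1`).  This is what makes the tame norm relation read
`cor y = (Fr⁻¹ − 1)²·z` modulo `p^{k+1}` (MEMO-es §15: `P_q(g⁻¹) = unit·ω²` in `Λ/(p^{k+1})`).
[cite: Rubin2000, Def. 2.1.1] [cite: SilvermanAEC2009, Thm. C.21.3] -/
theorem map_toZModPow_rubinEulerFactor_eq_of_galoisRepTorsion_pow_eq_one [ContinuousSMul ℤ_[p] (W.tateModule p)]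
    [Module.Free ℤ_[p] (W.tateModule p)] [Module.Finite ℤ_[p] (W.tateModule p)]
    {v : HeightOneSpectrum (𝓞 ℚ)} (hne : ((primesEquiv v : Nat.Primes) : ℕ) ≠ p)
    (hgood : W.HasGoodReductionAt v) {Fr : absoluteGaloisGroup ℚ} (hFr : IsArithFrobAtPlace ℚ v Fr)
    (h1 : galoisRepTorsion W ((p : ℤ) ^ (k + 1)) Fr = 1) :
    (rubinEulerFactor (tateRep W p).toRepresentation
        (cyclotomicCharacterToUnits ℚ p ℤ_[p]) Fr).map (PadicInt.toZModPow (k + 1)) =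
      ((1 - X) ^ 2 : ℤ[X]).map (Int.castRingHom (ZMod (p ^ (k + 1)))) := by
  obtain ⟨hq1, ha2⟩ :=
    natCast_eq_one_and_frobeniusTrace_eq_two_of_galoisRepTorsion_pow_eq_one W p k hne hgood hFr h1
  obtain ⟨u, hu, hP⟩ := CyclotomicLevel.Rat.rubinEulerFactor_galoisRepTate W p hne hgood hFr
  have hu1 : PadicInt.toZModPow (k + 1) (u : ℤ_[p]) = 1 := by rw [hu, map_natCast, hq1]
  have hui : PadicInt.toZModPow (k + 1) (↑u⁻¹ : ℤ_[p]) = 1 := by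
    have h := congrArg (PadicInt.toZModPow (k + 1)) (u.inv_mul : (↑u⁻¹ : ℤ_[p]) * ↑u = 1)
    rwa [map_mul, hu1, mul_one, map_one] at h
  have hcoef : PadicInt.toZModPow (k + 1)
      ((↑u⁻¹ : ℤ_[p]) * (W.frobeniusTrace (primesEquiv v) : ℤ_[p])) = 2 := by
    rw [map_mul, hui, one_mul, map_intCast, ha2]
  change (rubinEulerFactor (W.galoisRepTate p) (cyclotomicCharacterToUnits ℚ p ℤ_[p]) Fr).map
    (PadicInt.toZModPow (k + 1)) = _
  rw [hP]
  simp only [Polynomial.map_add, Polynomial.map_sub, Polynomial.map_one, Polynomial.map_mul,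
    Polynomial.map_pow, Polynomial.map_X, Polynomial.map_C, hcoef, hui]
  -- `1 - C 2 * X + C 1 * X ^ 2 = (1 - X) ^ 2`
  rw [map_one, one_mul, show (C (2 : ZMod (p ^ (k + 1))) : (ZMod (p ^ (k + 1)))[X]) = 2 from map_ofNat C 2]
  ring

omit [W.IsElliptic] [Fact p.Prime] in
/-- **`p^{k+1} ∣ ℓ − 1` at an `E[p^{k+1}]`-split Frobenius** (`ℓ = N(v) ≡ 1 (mod p^{k+1})`): the local
cyclotomic condition making `ℤ/p^{k+1}(1) = ℤ/p^{k+1}` over `ℚ_ℓ` and `Gal(ℚ_ℓ(μ_ℓ)/ℚ_ℓ) ↠ ℤ/p^{k+1}` (the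
hypothesis `hpl` of the local theory, level `p^{k+1}`). [cite: Serre1972, §1.11] -/
theorem pow_dvd_primesEquiv_sub_one_of_natCast_eq_one {v : HeightOneSpectrum (𝓞 ℚ)}
    (hq1 : ((((primesEquiv v : Nat.Primes) : ℕ) : ℕ) : ZMod (p ^ (k + 1))) = 1) :
    p ^ (k + 1) ∣ ((primesEquiv v : Nat.Primes) : ℕ) - 1 := by
  have hle : 1 ≤ ((primesEquiv v : Nat.Primes) : ℕ) := (primesEquiv v).2.one_lt.le
  have h : ((primesEquiv v : Nat.Primes) : ℕ) ≡ 1 [MOD p ^ (k + 1)] :=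
    (ZMod.natCast_eq_natCast_iff _ _ _).mp (by rw [Nat.cast_one]; exact hq1)
  exact (Nat.modEq_iff_dvd' hle).mp h.symm

end Summit.BirchSwinnertonDyer.BirchSwinnertonDyer.Theorems.OneSidedTwistSqueezeX9KatoDivisibilityX9KolyvaginReciprocityPkEulerFactor

end
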